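import Summits.QuantumFields.YangMills.Theorems.FlatTubeReductionSymmetricNearPair
import Summits.QuantumFields.YangMills.Theorems.FlatTubeReductionKernelMixedDifference
import Summits.QuantumFields.YangMills.Theorems.LuscherReductionTwistedTraceScalingBTCorePair
import Summits.QuantumFields.YangMills.Theorems.LuscherReductionTwistedTraceScalingBTFarPairs
import HarnessLib

/-!
# The SYMMETRIC CORE-PAIR SANDWICH with explicit rates: on the slow window, for a near pair and a core-supported profile / inversion-symmetric core weight,
# `|f(u,u') − √f(u,u)√f(u',u')| ≤ (ξ + 120η²)·√f(u,u)√f(u',u')`, `f = fpBOKernel/K₁`, with `η` = lane A's near-pair rate at SPLIT radii (fibre `t`, gauge `T`) and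
# `ξ = β|E|α²(6t + 2T)²` (route `FlatTubeReduction`, crux K1 `NearFlatRatioLaw` stmt-QuantumFields-24720; seat `ym-line-ftr-p1` g15; rate twin «ratepack-v3 / frozen fibres»;
# R2b1 RECORD rung — no summit statement is proved here)

WHY (memo `Cruxes/NearFlatRatioLaw/Lines/ratepack-v3-frozen-g12.md` §5.1, §8.4; PICKED.md g15).  `…SymmetricNearPair.fpBOKernel_near_dressed` reduces the dressed near-pair comparison to
pointwise bounds `η` (on `offX(u,u')`, `offX(u',u)`) and `ξ` (on their sum) on the support.  This file discharges them from the window/core data exactly as lane A's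
`…BTCorePair.core_pair_two_sided` does for the first-order sandwich, with ONE change that matters at the rate: the fibre radius `t` (profile support, `β^{-1/2}`, no log) and the gauge
radius `T` (`β^{-1/2}·polylog`) are kept SEPARATE — the magnetic error `stepActionErr t σ` must be log-free because `η²` sits at the scale `β^{-2/3}` of `λ_b²`.
* `abs_offX_le_split` — lane A's `abs_offX_le` with split radii (kinetic part at `T`, magnetic part at `t`);
* `norm_su2Quat_chartSU2_sub_one_le_three` — `‖q(chart v_e) − 1‖ ≤ 3t` for `|v_{e,c}| ≤ t ≤ 1/30`;
* ★★★ `core_pair_symm_dressed` — the sandwich, for `Ω ≥ 0` supported in `{cap-balanced, |v_{e,c}| ≤ t, ‖v̂‖ ≤ R}` and `W ≥ 0` inversion symmetric supported in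
  `{‖q(g_x) − 1‖ ≤ T, ‖Σ_x g⃗_x‖ ≤ Γ}`, window `‖q(u_k) − 1‖, ‖q(u'_k) − 1‖ ≤ δ`, near `‖q(u_k) − q(u'_k)‖ ≤ α ≤ 1`, actions `L³S₁ ≤ σ < 2`, `t ≤ T ≤ 1/30`, and `η ≤ 1`.
Sizes at the record scales (`t = R = β^{-1/2}`, `T ≍ β^{-1/2}log β`, `α² ≍ log B/B`, `σ = 12L³δ₁⁴ ≍ β^{-2/3}`, `Γ ≍ Nβ^{-1}`, `δ ≍ β^{-1/6}`): `ξ = O(β⁻¹polylog)`,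
`η = 1728N_P√(12L³)δ₁²·(1+o(1)) ≍ β^{-1/3}` (log-free) ⇒ `ξ + 120η² = O(β^{-2/3}) = O(λ_b²)` with an `L`-dependent constant.
HONEST FRAMING: bookkeeping of landed bricks for a stub of the CONDITIONAL reduction route R2b1; far pairs / tails / schedule / colour average remain; femto rung R2b1 (RECORD label);
not infinite volume, not a gap, not Clay.  No defs, no named facts, no `sorry`.
-/

set_option autoImplicit false

noncomputable section

open MeasureTheory Filter Topology Real
open scoped BigOperators Matrix Quaternion
open Literature.MathematicalPhysics.QuantumFieldTheory
open Literature.MathematicalPhysics.QuantumLattice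

namespace Summit.QuantumFields.YangMills.Theorems.FemtoTransferGap.TwoLattice.ConstTube

open Summit.QuantumFields.YangMills.Theorems.FemtoTransferGap
open Summit.QuantumFields.YangMills.Theorems.FemtoTransferGap.TwoLattice
open Summit.QuantumFields.YangMills.Theorems.FemtoTransferGap.TwoLattice.Avg
open Summit.QuantumFields.YangMills.Theorems.FemtoTransferGap.TwoLattice.Stiff (LinkSpace)
open Summit.QuantumFields.YangMills.Theorems.FemtoTransferGap.TwoLattice.Cov

variable {L : ℕ} [NeZero L]

/-! ## §1 Lane A's pointwise `offX` bound with split radii -/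

/-- ★ **`|offX| ≤ η(t,T)`** — `…BTOffDiagonalBound.abs_offX_le` with the fibre coordinates at radius `t` (magnetic part) and the gauge/fibre near-identity factors at radius `T ≥ t`
(kinetic part). [cite: Luscher1983, §3] -/
theorem abs_offX_le_split {β : ℝ} (hβ : 0 ≤ β) (u u' : GaugeConfig 3 1 SU2) {v v' : Edge 3 L → Fin 3 → ℝ} (hv : v ∈ capBalancedSet L) (hv' : v' ∈ capBalancedSet L)
    {t T σ α τu Γ : ℝ} (htT : t ≤ T) (hT : T ≤ 1 / 30) (hσ : σ < 2) (hS : (L : ℝ) ^ 3 * wilsonAction su2Rep u ≤ σ) (hS' : (L : ℝ) ^ 3 * wilsonAction su2Rep u' ≤ σ)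
    (hvt : ∀ (e : Edge 3 L) (c : Fin 3), |v e c| ≤ t) (hv't : ∀ (e : Edge 3 L) (c : Fin 3), |v' e c| ≤ t) {g : Site 3 L → SU2}
    (hg0 : ∀ x, 0 ≤ scalarPart (g x)) (hgT : ∀ x, ∑ c, vecPart (g x) c ^ 2 ≤ T ^ 2) (hΓ : ‖∑ x, vecPart (g x)‖ ≤ Γ) (hα1 : α ≤ 1)
    (ha : ∀ k c, |vecPart (u (0, k) * (u' (0, k))⁻¹) c| ≤ α) (hw0 : ∀ k, 0 ≤ scalarPart (u (0, k) * (u' (0, k))⁻¹)) (hu : ∀ k, ‖vecPart (u (0, k))‖ ≤ τu) :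
    |offX L β u u' v v' g| ≤
      β * ((Fintype.card (Edge 3 L) : ℝ) * (558 * α ^ 2 * T ^ 2 + 192 * α * T ^ 2) + 216 * α * τu * Γ) +
        β / 2 * (100 * σ * (Fintype.card (Plaquette 3 L × Fin 3) : ℝ) * ‖linkEmbed L v'‖ ^ 2 + 2 * stepActionErr (L := L) t σ +
          10080 * α * (Fintype.card (Plaquette 3 L × Fin 3) : ℝ) * ‖linkEmbed L v'‖ ^ 2) := by
  have ht : t ≤ 1 / 30 := htT.trans hT
  have hK := abs_offKinetic_le u u' hv hv' (by linarith) (fun e c => (hvt e c).trans htT) (fun e c => (hv't e c).trans htT) hg0 hgT hΓ ha hw0 hu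
  have hM := abs_offMagnetic_le u u' hv' ht hσ hS hS' hv't hα1 ha
  have e : offX L β u u' v v' g =
      β * ∑ e : Edge 3 L, 2 * ((scalarPart (u (0, e.2) * (u' (0, e.2))⁻¹) - 1) * (scalarPart (linkQ L u v v' g e) - 1) -
          vecPart (u (0, e.2) * (u' (0, e.2))⁻¹) ⬝ᵥ vecPart (linkQ L u v v' g e)) -
        β / 2 * ((wilsonAction su2Rep (orthoTube L u' v') - (L : ℝ) ^ 3 * wilsonAction su2Rep u') - (wilsonAction su2Rep (orthoTube L u v') - (L : ℝ) ^ 3 * wilsonAction su2Rep u)) := by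
    unfold offX; rw [offKinetic_eq]
  rw [e]
  refine (abs_sub _ _).trans ?_
  rw [abs_mul, abs_mul, abs_of_nonneg hβ, abs_of_nonneg (by linarith : (0 : ℝ) ≤ β / 2)]
  exact add_le_add (mul_le_mul_of_nonneg_left hK hβ) (mul_le_mul_of_nonneg_left hM (by linarith))

/-! ## §2 The chart quaternion near `1` -/

omit [NeZero L] in
/-- `‖q(chartSU2 w) − 1‖ ≤ 3t` for `|w_c| ≤ t ≤ 1/30`. [folklore] -/
theorem norm_su2Quat_chartSU2_sub_one_le_three {w : Fin 3 → ℝ} {t : ℝ} (ht : t ≤ 1 / 30) (hw : ∀ c, |w c| ≤ t) : ‖su2Quat (chartSU2 w) - 1‖ ≤ 3 * t := by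
  have ht0 : 0 ≤ t := (abs_nonneg _).trans (hw 0)
  have hsum : ∑ a, w a ^ 2 ≤ 3 * t ^ 2 := by
    rw [Fin.sum_univ_three]
    have b0 := pow_le_pow_left₀ (abs_nonneg _) (hw 0) 2
    have b1 := pow_le_pow_left₀ (abs_nonneg _) (hw 1) 2
    have b2 := pow_le_pow_left₀ (abs_nonneg _) (hw 2) 2
    rw [sq_abs] at b0 b1 b2
    linarith
  have h1 : ∑ a, w a ^ 2 ≤ 1 := hsum.trans (by nlinarith)
  rw [Summit.QuantumFields.YangMills.Theorems.FemtoTransferGap.su2Quat_chartSU2 h1]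
  have h2 := norm_chartQuat_sub_one_sq_le h1
  have h3 : ‖chartQuat w - 1‖ ^ 2 ≤ (3 * t) ^ 2 := by nlinarith
  exact (pow_le_pow_iff_left₀ (norm_nonneg _) (by positivity) two_ne_zero).mp h3

/-! ## §3 ★★★ The symmetric core-pair sandwich -/

set_option maxHeartbeats 800000 in
/-- ★★★ **THE SYMMETRIC CORE-PAIR SANDWICH** (dressed near-pair comparison with explicit rates).  `β ≥ 0`; `Ω ≥ 0` bounded measurable, supported in
`{v cap-balanced, |v_{e,c}| ≤ t, ‖v̂‖ ≤ R}`; `W ≥ 0` bounded measurable, inversion symmetric, supported in `{∀x ‖q(g_x) − 1‖ ≤ T, ‖Σ_x g⃗_x‖ ≤ Γ}`; window `‖q(u_k)−1‖, ‖q(u'_k)−1‖ ≤ δ`;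
near pair `‖q(u_k) − q(u'_k)‖ ≤ α ≤ 1`; `t ≤ T ≤ 1/30`; `L³S₁(u), L³S₁(u') ≤ σ < 2`; and the rate
`η = β(|E|(558α²T² + 192αT²) + 216αδΓ) + (β/2)(100σN_PR² + 2·stepActionErr t σ + 10080αN_PR²) ≤ 1`.  Then with `f(a,b) = fpBOKernel β Ω W a b / K₁^{(L³β)}(a,b)` and
`ξ = β|E|α²(6t + 2T)²`: `|f(u,u') − √f(u,u)·√f(u',u')| ≤ (ξ + 120η²)·√f(u,u)·√f(u',u')`. [cite: Luscher1983, §3] -/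
theorem core_pair_symm_dressed {β : ℝ} (hβ : 0 ≤ β) {Ω : LinkSpace L → ℝ} (hΩm : Measurable Ω) {CΩ : ℝ} (hCΩ : ∀ x, |Ω x| ≤ CΩ) (hΩ0 : ∀ x, 0 ≤ Ω x)
    {W : (Site 3 L → SU2) → ℝ} (hW : Measurable W) {CW : ℝ} (hCW : ∀ g, |W g| ≤ CW) (hW0 : ∀ g, 0 ≤ W g) (hWinv : ∀ g, W g⁻¹ = W g) (u u' : GaugeConfig 3 1 SU2)
    {δ α t T R Γ σ : ℝ}
    (hδ : ∀ k : Fin 3, ‖su2Quat (u (0, k)) - 1‖ ≤ δ) (hδ' : ∀ k : Fin 3, ‖su2Quat (u' (0, k)) - 1‖ ≤ δ)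
    (hα : ∀ k : Fin 3, ‖su2Quat (u (0, k)) - su2Quat (u' (0, k))‖ ≤ α) (hα1 : α ≤ 1)
    (ht0 : 0 ≤ t) (htT : t ≤ T) (hT : T ≤ 1 / 30) (hΓ0 : 0 ≤ Γ) (hσ : σ < 2) (hS : (L : ℝ) ^ 3 * wilsonAction su2Rep u ≤ σ)
    (hS' : (L : ℝ) ^ 3 * wilsonAction su2Rep u' ≤ σ)
    (hΩt : ∀ v : Edge 3 L → Fin 3 → ℝ, Ω (linkEmbed L v) ≠ 0 → v ∈ capBalancedSet L ∧ (∀ (e : Edge 3 L) (c : Fin 3), |v e c| ≤ t) ∧ ‖linkEmbed L v‖ ≤ R)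
    (hWc : ∀ g : Site 3 L → SU2, W g ≠ 0 → (∀ x, ‖su2Quat (g x) - 1‖ ≤ T) ∧ ‖∑ x, vecPart (g x)‖ ≤ Γ)
    (hη1 : β * ((Fintype.card (Edge 3 L) : ℝ) * (558 * α ^ 2 * T ^ 2 + 192 * α * T ^ 2) + 216 * α * δ * Γ) +
        β / 2 * (100 * σ * (Fintype.card (Plaquette 3 L × Fin 3) : ℝ) * R ^ 2 + 2 * stepActionErr (L := L) t σ + 10080 * α * (Fintype.card (Plaquette 3 L × Fin 3) : ℝ) * R ^ 2) ≤ 1) :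
    |fpBOKernel L β Ω W u u' / transferKernel su2Rep ((L : ℝ) ^ 3 * β) u u' -
        Real.sqrt (fpBOKernel L β Ω W u u / transferKernel su2Rep ((L : ℝ) ^ 3 * β) u u) * Real.sqrt (fpBOKernel L β Ω W u' u' / transferKernel su2Rep ((L : ℝ) ^ 3 * β) u' u')| ≤
      (β * (Fintype.card (Edge 3 L) : ℝ) * α ^ 2 * (6 * t + 2 * T) ^ 2 +
          120 * (β * ((Fintype.card (Edge 3 L) : ℝ) * (558 * α ^ 2 * T ^ 2 + 192 * α * T ^ 2) + 216 * α * δ * Γ) +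
            β / 2 * (100 * σ * (Fintype.card (Plaquette 3 L × Fin 3) : ℝ) * R ^ 2 + 2 * stepActionErr (L := L) t σ +
              10080 * α * (Fintype.card (Plaquette 3 L × Fin 3) : ℝ) * R ^ 2)) ^ 2) *
        (Real.sqrt (fpBOKernel L β Ω W u u / transferKernel su2Rep ((L : ℝ) ^ 3 * β) u u) *
          Real.sqrt (fpBOKernel L β Ω W u' u' / transferKernel su2Rep ((L : ℝ) ^ 3 * β) u' u')) := by
  -- sizes of the slow data
  have hδ0 : 0 ≤ δ := (norm_nonneg _).trans (hδ 0)
  have hα0 : 0 ≤ α := (norm_nonneg _).trans (hα 0)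
  have hα' : ∀ k : Fin 3, ‖su2Quat (u' (0, k)) - su2Quat (u (0, k))‖ ≤ α := fun k => by rw [norm_sub_rev]; exact hα k
  have ha : ∀ (k : Fin 3) (c : Fin 3), |vecPart (u (0, k) * (u' (0, k))⁻¹) c| ≤ α := fun k c => by
    refine (abs_vecPart_le_norm_sub_one _ c).trans ?_
    rw [norm_su2Quat_mul_inv_sub_one]; exact hα k
  have ha' : ∀ (k : Fin 3) (c : Fin 3), |vecPart (u' (0, k) * (u (0, k))⁻¹) c| ≤ α := fun k c => by
    refine (abs_vecPart_le_norm_sub_one _ c).trans ?_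
    rw [norm_su2Quat_mul_inv_sub_one]; exact hα' k
  have hw0 : ∀ k : Fin 3, 0 ≤ scalarPart (u (0, k) * (u' (0, k))⁻¹) := fun k =>
    scalarPart_mul_inv_nonneg (by nlinarith [pow_le_pow_left₀ (norm_nonneg _) ((hα k).trans hα1) 2, norm_nonneg (su2Quat (u (0, k)) - su2Quat (u' (0, k)))])
  have hw0' : ∀ k : Fin 3, 0 ≤ scalarPart (u' (0, k) * (u (0, k))⁻¹) := fun k =>
    scalarPart_mul_inv_nonneg (by nlinarith [pow_le_pow_left₀ (norm_nonneg _) ((hα' k).trans hα1) 2, norm_nonneg (su2Quat (u' (0, k)) - su2Quat (u (0, k)))])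
  have hun : ∀ k : Fin 3, ‖vecPart (u (0, k))‖ ≤ δ := fun k => (norm_vecPart_le_norm_sub_one _).trans (hδ k)
  have hun' : ∀ k : Fin 3, ‖vecPart (u' (0, k))‖ ≤ δ := fun k => (norm_vecPart_le_norm_sub_one _).trans (hδ' k)
  -- gauge core data in the shape `abs_offKinetic_le` wants
  have hWc' : ∀ g : Site 3 L → SU2, W g ≠ 0 → (∀ x, 0 ≤ scalarPart (g x)) ∧ (∀ x, ∑ c, vecPart (g x) c ^ 2 ≤ T ^ 2) ∧ ‖∑ x, vecPart (g x)‖ ≤ Γ := fun g hg =>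
    ⟨fun x => scalarPart_nonneg_of_norm_sub_one_le (((hWc g hg).1 x).trans (by linarith)),
      fun x => (sum_sq_vecPart_le_norm_sub_one_sq _).trans (pow_le_pow_left₀ (norm_nonneg _) ((hWc g hg).1 x) 2), (hWc g hg).2⟩
  have hσ0 : 0 ≤ σ := le_trans (mul_nonneg (by positivity) (wilsonAction_su2_nonneg u)) hS
  have hN0 : (0 : ℝ) ≤ Fintype.card (Plaquette 3 L × Fin 3) := Nat.cast_nonneg _
  have hE0 : (0 : ℝ) ≤ Fintype.card (Edge 3 L) := Nat.cast_nonneg _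
  have hT0 : 0 ≤ T := ht0.trans htT
  have hstep0 : 0 ≤ stepActionErr (L := L) t σ := stepActionErr_nonneg ht0
  have hη0 : 0 ≤ β * ((Fintype.card (Edge 3 L) : ℝ) * (558 * α ^ 2 * T ^ 2 + 192 * α * T ^ 2) + 216 * α * δ * Γ) +
      β / 2 * (100 * σ * (Fintype.card (Plaquette 3 L × Fin 3) : ℝ) * R ^ 2 + 2 * stepActionErr (L := L) t σ + 10080 * α * (Fintype.card (Plaquette 3 L × Fin 3) : ℝ) * R ^ 2) := by
    positivity
  have hξ0 : 0 ≤ β * (Fintype.card (Edge 3 L) : ℝ) * α ^ 2 * (6 * t + 2 * T) ^ 2 := by positivity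
  refine fpBOKernel_near_dressed β hΩm hCΩ hΩ0 hW hCW hW0 hWinv u u' hη0 hη1 hξ0 ?_ ?_
  · -- `η`: lane A's bound at `(u,u')` and at `(u',u)`
    intro v v' g hv hv' hg
    obtain ⟨hvc, hvt, hvR⟩ := hΩt v hv
    obtain ⟨hv'c, hv't, hv'R⟩ := hΩt v' hv'
    obtain ⟨hg0, hgT, hgΓ⟩ := hWc' g hg
    have hR2 : ‖linkEmbed L v'‖ ^ 2 ≤ R ^ 2 := pow_le_pow_left₀ (norm_nonneg _) hv'R 2
    have k1 := mul_le_mul_of_nonneg_left hR2 (mul_nonneg (mul_nonneg (by norm_num : (0 : ℝ) ≤ 100) hσ0) hN0)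
    have k2 := mul_le_mul_of_nonneg_left hR2 (mul_nonneg (mul_nonneg (by norm_num : (0 : ℝ) ≤ 10080) hα0) hN0)
    have k := mul_le_mul_of_nonneg_left (add_le_add k1 k2) (by linarith : (0 : ℝ) ≤ β / 2)
    constructor
    · have h := abs_offX_le_split hβ u u' hvc hv'c htT hT hσ hS hS' hvt hv't hg0 hgT hgΓ hα1 ha hw0 hun
      linarith [h, k]
    · have h := abs_offX_le_split hβ u' u hvc hv'c htT hT hσ hS' hS hvt hv't hg0 hgT hgΓ hα1 ha' hw0' hun'
      linarith [h, k]
  · -- `ξ`: the exact mixed second difference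
    intro v v' g hv hv' hg
    obtain ⟨-, hvt, -⟩ := hΩt v hv
    obtain ⟨-, hv't, -⟩ := hΩt v' hv'
    obtain ⟨hgT, -⟩ := hWc g hg
    have ht : t ≤ 1 / 30 := htT.trans hT
    refine (abs_offX_add_offX_swap_le hβ u u' v v' g).trans ?_
    have hper : ∀ e : Edge 3 L, ‖su2Quat (u (0, e.2)) - su2Quat (u' (0, e.2))‖ ^ 2 *
        (‖su2Quat (chartSU2 (v e)) - 1‖ + ‖su2Quat (g e.1) - 1‖ + ‖su2Quat (chartSU2 (v' e)) - 1‖ + ‖su2Quat (g (e.1.shift e.2)) - 1‖) ^ 2 ≤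
        α ^ 2 * (6 * t + 2 * T) ^ 2 := fun e => by
      have h1 : ‖su2Quat (u (0, e.2)) - su2Quat (u' (0, e.2))‖ ^ 2 ≤ α ^ 2 := pow_le_pow_left₀ (norm_nonneg _) (hα e.2) 2
      have hs0 : 0 ≤ ‖su2Quat (chartSU2 (v e)) - 1‖ + ‖su2Quat (g e.1) - 1‖ + ‖su2Quat (chartSU2 (v' e)) - 1‖ + ‖su2Quat (g (e.1.shift e.2)) - 1‖ := by positivity
      have hs : ‖su2Quat (chartSU2 (v e)) - 1‖ + ‖su2Quat (g e.1) - 1‖ + ‖su2Quat (chartSU2 (v' e)) - 1‖ + ‖su2Quat (g (e.1.shift e.2)) - 1‖ ≤ 6 * t + 2 * T := by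
        have a1 := norm_su2Quat_chartSU2_sub_one_le_three ht (hvt e)
        have a2 := norm_su2Quat_chartSU2_sub_one_le_three ht (hv't e)
        have a3 := hgT e.1
        have a4 := hgT (e.1.shift e.2)
        linarith
      have h2 := pow_le_pow_left₀ hs0 hs 2
      exact mul_le_mul h1 h2 (sq_nonneg _) (sq_nonneg _)
    calc β * ∑ e : Edge 3 L, ‖su2Quat (u (0, e.2)) - su2Quat (u' (0, e.2))‖ ^ 2 *
          (‖su2Quat (chartSU2 (v e)) - 1‖ + ‖su2Quat (g e.1) - 1‖ + ‖su2Quat (chartSU2 (v' e)) - 1‖ + ‖su2Quat (g (e.1.shift e.2)) - 1‖) ^ 2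
        ≤ β * ∑ _e : Edge 3 L, α ^ 2 * (6 * t + 2 * T) ^ 2 := mul_le_mul_of_nonneg_left (Finset.sum_le_sum fun e _ => hper e) hβ
      _ = β * (Fintype.card (Edge 3 L) : ℝ) * α ^ 2 * (6 * t + 2 * T) ^ 2 := by rw [Finset.sum_const, Finset.card_univ, nsmul_eq_mul]; ring

end Summit.QuantumFields.YangMills.Theorems.FemtoTransferGap.TwoLattice.ConstTube

end
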